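import Summits.Langlands.Langlands.Theorems.IrreducibilityBySelfDualityReciprocityUpToIrreducibilityRankOneMatching
import HarnessLib

/-!
# Line `Sketch` for the crux `ReciprocityUpToIrreducibility` (item stmt-Langlands-14328), continuation c7:
# stub S-C — the rank-one matching at an ARBITRARY place

Support file (closes nothing; registered stub `stub_rankOne_recGL_matching_of_forall` of line
`Sketch`, continuation lead c7, wave N7).

The summit's clause at a finite place asks `rℂ.HasFrobSemisimpleClass ((Rec.llc v).recGL n [π_v])`.
In rank one `rec₁[χ ∘ det] = [(χ ∘ artin, N = 0)]` for EVERY local Langlands datum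
(`IsLocalLanglandsGL.rec_one_mk`: every local Langlands correspondence is local class field theory in
degree one).  Lead c4 settled the UNRAMIFIED case with one Frobenius
(`hasFrobSemisimpleClass_recGL_one_of_isUnramifiedRep`); here the quasi-character `χ` of `Fˣ` is
arbitrary (ramified allowed) and the hypothesis is `r.ρ(w) = χ(artin w) • id` for ALL `w ∈ W_F`:

* `eq_ofQuasiCharOn_of_forall` — a Weil–Deligne representation `r` on any complex space `V` with
  `N = 0` and `r.ρ(w) = χ(artin w) • id` for all `w` IS `ofQuasiCharOn V hns d χ` (extensionality).
* `hasFrobSemisimpleClass_recGL_one_of_forall` — on `V = ℂ¹ = Fin 1 → ℂ` such an `r` is the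
  representative `ofQuasiCharOn (Fin 1 → ℂ) L.hns L.artin χ` of `L.recGL 1 [χ ∘ det]`
  (`IsLocalLanglandsGL.rec_one_mk`) and is Frobenius-semisimple, so it has that class.
* `stub_rankOne_recGL_matching_of_forall` — the registered stub (closed form).

No definitions; standard axioms only; no named fact assumed.
-/

noncomputable section

set_option linter.dupNamespace false -- project-wide option (lakefile weak.linter.dupNamespace); `Summit.Langlands.Langlands` is the mandated namespace

open scoped MatrixGroups Matrix NumberField Classical
open Filter IsDedekindDomain Field
open Literature.NumberTheory.Automorphic Literature.NumberTheory.GaloisRepresentations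
open Literature.NumberTheory.PAdicHodge
open Summit.Langlands

namespace Summit.Langlands.Langlands.Theorems.ReciprocityUpToIrreducibility

section Local

variable {F : Type} [Field F] [ValuativeRel F] [TopologicalSpace F] [IsNonarchimedeanLocalField F]

/-- **Extensionality against `ofQuasiCharOn`.**  Let `χ` be a quasi-character of `Fˣ`, `d` a local
Artin datum and `r` a Weil–Deligne representation on a complex space `V` with `N = 0` and
`r.ρ(w) = χ(artin w) • id` for every `w ∈ W_F`.  Then `r = (χ ∘ artin • id, 0) = ofQuasiCharOn V hns d χ`:
the two Weil–Deligne representations have the same `ρ` (pointwise, `ofQuasiCharOn_ρ_apply`) and the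
same `N = 0`. [cite: TateCorvallis1979, (1.4.5) and (4.1.3)] -/
theorem eq_ofQuasiCharOn_of_forall
    (hns : WeilGroup.exists_subgroup_le_inertia_isOpen_of_continuous (F := F))
    (d : LocalArtinData F) {χ : QuasiChar F}
    {V : Type*} [AddCommGroup V] [Module ℂ V]
    (r : WeilDeligneRep F ℂ V) (hN : r.N = 0)
    (hρ : ∀ w : WeilGroup F, r.ρ w = ((χ (d.artin w) : ℂˣ) : ℂ) • LinearMap.id) :
    r = WeilDeligneRep.ofQuasiCharOn V hns d χ := by
  have hρ' : ∀ w, r.ρ w = (WeilDeligneRep.ofQuasiCharOn V hns d χ).ρ w := fun w => by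
    rw [hρ w]
    exact LinearMap.ext fun v => rfl
  cases r with
  | mk ρr hc N hnil hconj =>
    have h1 : ρr = (WeilDeligneRep.ofQuasiCharOn V hns d χ).ρ := MonoidHom.ext fun w => hρ' w
    have h2 : N = 0 := hN
    subst h1 h2
    rfl

/-- **The rank-one matching at an arbitrary place.**  For every local Langlands datum `L` of `F`,
every quasi-character `χ` of `Fˣ` (ramified or not) and every Weil–Deligne representation `r` on
`ℂ¹ = Fin 1 → ℂ` with `N = 0` and `r.ρ(w) = χ(artin w) • id` for all `w ∈ W_F`: the
Frobenius-semisimplification of `r` has class `L.recGL 1 [χ ∘ det]`.  Indeed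
`r = ofQuasiCharOn (Fin 1 → ℂ) L.hns L.artin χ` (`eq_ofQuasiCharOn_of_forall`), which is
Frobenius-semisimple (`isFrobSemisimple_ofQuasiCharOn`) and represents `L.recGL 1 [χ ∘ det]` because
every local Langlands correspondence is local class field theory in degree one
(`IsLocalLanglandsGL.rec_one_mk`, Harris–Taylor 2001, Thm. A (i)).
[cite: HarrisTaylorAMS2001, Thm. A (i)] [cite: TateCorvallis1979, (1.4.5) and (4.1.3)] -/
theorem hasFrobSemisimpleClass_recGL_one_of_forall (L : LocalLanglandsDatum F) {χ : QuasiChar F}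
    (r : WeilDeligneRep F ℂ (Fin 1 → ℂ)) (hN : r.N = 0)
    (hρ : ∀ w : WeilGroup F, r.ρ w = ((χ (L.artin.artin w) : ℂˣ) : ℂ) • LinearMap.id) :
    r.HasFrobSemisimpleClass (L.recGL 1 (IrrClass.mk (SmoothIrrep.ofQuasiChar χ))) := by
  rw [eq_ofQuasiCharOn_of_forall L.hns L.artin r hN hρ,
    L.isLocalLanglands.rec_one_mk (SmoothIrrep.ofQuasiChar_ρ_apply χ)]
  exact (WeilDeligneRep.isFrobSemisimple_ofQuasiCharOn L.hns L.artin χ).hasFrobSemisimpleClass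

end Local

/-- **Registered stub `stub_rankOne_recGL_matching_of_forall` of line `Sketch` (crux
stmt-Langlands-14328, c7 wave N7)**, closed form of `hasFrobSemisimpleClass_recGL_one_of_forall`:
for every local Langlands datum `L` of a non-archimedean local field `F`, every quasi-character `χ`
of `Fˣ` (ramified or not) and every Weil–Deligne representation `r` on `ℂ¹ = Fin 1 → ℂ` with `N = 0`
and `r.ρ(w) = χ(artin w) • id` for ALL `w ∈ W_F`, `r = r^{F-ss}` has class `L.recGL 1 [χ ∘ det]`
(`r = ofQuasiCharOn (Fin 1 → ℂ) L.hns L.artin χ` by extensionality; `IsLocalLanglandsGL.rec_one_mk`).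
[cite: HarrisTaylorAMS2001, Thm. A (i)] [cite: TateCorvallis1979, (1.4.5) and (4.1.3)] -/
theorem stub_rankOne_recGL_matching_of_forall :
    ∀ (F : Type) [Field F] [ValuativeRel F] [TopologicalSpace F] [IsNonarchimedeanLocalField F]
      (L : LocalLanglandsDatum F) (χ : QuasiChar F) (r : WeilDeligneRep F ℂ (Fin 1 → ℂ)),
      r.N = 0 → (∀ w : WeilGroup F, r.ρ w = ((χ (L.artin.artin w) : ℂˣ) : ℂ) • LinearMap.id) →
      r.HasFrobSemisimpleClass (L.recGL 1 (IrrClass.mk (SmoothIrrep.ofQuasiChar χ))) :=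
  fun _ _ _ _ _ L _ r hN hρ => hasFrobSemisimpleClass_recGL_one_of_forall L r hN hρ

end Summit.Langlands.Langlands.Theorems.ReciprocityUpToIrreducibility

end
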